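import Mathlib
import HarnessLib
import Summits.ResolutionOfSingularities.ResolutionOfSingularities.Theorems.WildQuotientsWildQuotientResolutionJordanFourI6StableJ4
import Summits.ResolutionOfSingularities.ResolutionOfSingularities.Theorems.WildQuotientsWildQuotientResolutionJordanFourOrder
import Summits.ResolutionOfSingularities.ResolutionOfSingularities.Theorems.WildQuotientsWildQuotientResolutionJordanFourPieceTwoBricks
import Summits.ResolutionOfSingularities.ResolutionOfSingularities.Theorems.WildQuotientsWildQuotientResolutionToricExitCover
import Summits.ResolutionOfSingularities.ResolutionOfSingularities.Theorems.WildQuotientsWildQuotientResolutionBlowupLocalExitAffine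
import Summits.ResolutionOfSingularities.ResolutionOfSingularities.Theorems.WildQuotientsWildQuotientResolutionBlowupChartRegularPiece
import Summits.ResolutionOfSingularities.ResolutionOfSingularities.Theorems.WildQuotientsWildQuotientResolutionAffineQuotientData
import Summits.ResolutionOfSingularities.ResolutionOfSingularities.Theorems.WildQuotientsWildQuotientResolutionAffineQuotientEtale
import Summits.ResolutionOfSingularities.ResolutionOfSingularities.Theorems.WildQuotientsWildQuotientResolutionLinearSmallBlocksAlgebra
import Summits.ResolutionOfSingularities.ResolutionOfSingularities.Theorems.WildQuotientsWildQuotientResolutionFixedPointsGraded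
import Literature.AlgebraicGeometry.Resolution.BlowupPrincipalCharts
import Literature.AlgebraicGeometry.Resolution.BlowupsEquivariant

/-!
# V4U plumbing for the `J₄` scaffold: group order, crux data, and the stable core of the smooth chart
(crux stmt-ResolutionOfSingularities-15640 `WildQuotients.WildQuotientResolution`, line `Sketch`;
chain w45c programme V4U, `L/w45c/CHAIN.md` v7 §4 row stub-5 «PLUMBING bricks of lead-1's V4U
scaffold»; written by res-D-pv-033 AS res-L1-w45c-stub-5; [OURS · L1 W4.5c] — NOT a statement of
any manuscript.)

`J₄` datum: `σ x_b = x_b + x_a`, `σ x_c = x_c + x_b`, `σ x_d = x_d + x_c`, passengers fixed,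
`char k = p ≥ 5`; `I₆` the generator vector of record, `V = Bl_{I₆} 𝔸ⁿ`,
`V[⊤, x_c⁶] = blowupChart π Ĩ₆ ⊤ x_c⁶`, lifted action `ρV = (affineBlowup.isBlowup _).liftAction ρ _`.
The inputs of `ToricExit.toricExitTransfer₃` (p500xxx, res-L1-w45c-lead-1) that are neither cone
algebra (T1/T2/B0/C) nor centre data (E):

* `JordanFour.finite_zpowers` — `⟨σ⟩` is finite (`JordanFour.card_zpowers_prime`, p492464);
* `JordanFour.exists_dense_etale` — `𝔸ⁿ → 𝔸ⁿ/⟨σ⟩` is étale over the dense open `D(x_a)`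
  (`AffineQuotient.exists_dense_etale_morphismRestrict` + `LinearSmallBlocks.X_mem_augIdeal_of_transvection`);
* `JordanFour.not_topologicalKrullDim_le_zero` — `dim 𝔸ⁿ/⟨σ⟩ = n > 0`;
* the STABLE CORE `⋂_g g⁻¹ V[⊤, x_c⁶]` of the smooth chart: affine (`isAffineOpen_core_chartC`),
  stable (`preimage_core_chartC_eq`), inside the chart (`core_chartC_le`), non-empty
  (`JordanFour.nonempty_iInf_preimage_blowupChart_I6_c`, p500230), regular as a scheme
  (`isRegular_core_chartC`, from `JordanFour.isRegular_of_le_blowupChart_I6_c`: every open inside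
  `V[⊤, x_c⁶]` is regular, p500230 + p492566 + p489276).
-/

-- single-problem summit: the doubled namespace component `ResolutionOfSingularities` is forced
set_option linter.dupNamespace false

noncomputable section

open CategoryTheory AlgebraicGeometry TopologicalSpace MvPolynomial HomogeneousLocalization
open Literature.AlgebraicGeometry.Resolution

namespace Summit.ResolutionOfSingularities.ResolutionOfSingularities.Theorems.WildQuotientResolution.JordanFour

/-! ## The group `⟨σ⟩` -/

/-- **`⟨σ⟩` is finite** (of order `p`; `JordanFour.card_zpowers_prime`). Use as
`haveI := JordanFour.finite_zpowers …` before any `StableAffineOpens`/`pieceQuot`-typed term.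
[folklore] -/
theorem finite_zpowers (p : ℕ) (hp : p.Prime) (hp5 : 5 ≤ p) (k : Type) [Field k] [CharP k p]
    (n : ℕ) (σ : MvPolynomial (Fin n) k ≃ₐ[k] MvPolynomial (Fin n) k) (a b c d : Fin n)
    (hab : a ≠ b) (hac : a ≠ c) (had : a ≠ d)
    (hb : σ (X b) = X b + X a) (hc : σ (X c) = X c + X b) (hd : σ (X d) = X d + X c)
    (hσ : ∀ i, i ≠ b → i ≠ c → i ≠ d → σ (X i) = X i) :
    Finite ↥(Subgroup.zpowers σ) := by
  apply Nat.finite_of_card_ne_zero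
  rw [card_zpowers_prime k n σ a b c d hab hac had hb hc hd hσ p hp hp5]
  exact hp.ne_zero

/-! ## Crux data of `𝔸ⁿ → 𝔸ⁿ/⟨σ⟩` -/

/-- **`x_a` is an invariant.** [folklore] -/
theorem X_a_mem_fixedPoints (k : Type) [Field k] (n : ℕ)
    (σ : MvPolynomial (Fin n) k ≃ₐ[k] MvPolynomial (Fin n) k) (a b c d : Fin n)
    (hab : a ≠ b) (hac : a ≠ c) (had : a ≠ d)
    (hσ : ∀ i, i ≠ b → i ≠ c → i ≠ d → σ (X i) = X i) :
    (X a : MvPolynomial (Fin n) k) ∈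
      FixedPoints.subalgebra k (MvPolynomial (Fin n) k) (Subgroup.zpowers σ) :=
  (TameTransfer.mem_fixedPoints_zpowers_iff_apply_eq σ (X a)).mpr (hσ a hab hac had)

/-- **`𝔸ⁿ → 𝔸ⁿ/⟨σ⟩` is étale over a dense open** (over `D(x_a)`: `x_a` lies in the augmentation
ideal of every `g ≠ 1`, `LinearSmallBlocks.X_mem_augIdeal_of_transvection`). [OURS · L1 W4.5c]
[folklore; assembly of landed decls] -/
theorem exists_dense_etale (p : ℕ) (hp : p.Prime) (hp5 : 5 ≤ p) (k : Type) [Field k] [CharP k p]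
    (n : ℕ) (σ : MvPolynomial (Fin n) k ≃ₐ[k] MvPolynomial (Fin n) k) [Finite ↥(Subgroup.zpowers σ)]
    (a b c d : Fin n) (hab : a ≠ b) (hac : a ≠ c) (had : a ≠ d)
    (hb : σ (X b) = X b + X a) (hc : σ (X c) = X c + X b) (hd : σ (X d) = X d + X c)
    (hσ : ∀ i, i ≠ b → i ≠ c → i ≠ d → σ (X i) = X i) :
    ∃ U : (Spec (.of (FixedPoints.subalgebra k (MvPolynomial (Fin n) k)
        (Subgroup.zpowers σ)))).Opens,
      Dense (U : Set (Spec (.of (FixedPoints.subalgebra k (MvPolynomial (Fin n) k)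
        (Subgroup.zpowers σ))))) ∧
      Etale (Spec.map (CommRingCat.ofHom (algebraMap
        (FixedPoints.subalgebra k (MvPolynomial (Fin n) k) (Subgroup.zpowers σ))
        (MvPolynomial (Fin n) k))) ∣_ U) := by
  have hσp : σ ^ p = 1 := pow_prime_eq_one k n σ a b c d hab hac had hb hc hd hσ p hp hp5
  have ha : σ (X a) = X a := hσ a hab hac had
  have ht0 : (⟨X a, X_a_mem_fixedPoints k n σ a b c d hab hac had hσ⟩ :
      FixedPoints.subalgebra k (MvPolynomial (Fin n) k) (Subgroup.zpowers σ)) ≠ 0 := fun h =>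
    MvPolynomial.X_ne_zero a (congrArg Subtype.val h)
  exact AffineQuotient.exists_dense_etale_morphismRestrict k _ ht0
    fun g hg => LinearSmallBlocks.X_mem_augIdeal_of_transvection k p hp σ a b ha hb hσp g hg

/-- **`dim 𝔸ⁿ/⟨σ⟩ > 0`** (it is `n ≥ 1`, as `a : Fin n`). [folklore] -/
theorem not_topologicalKrullDim_le_zero (k : Type) [Field k] (n : ℕ)
    (σ : MvPolynomial (Fin n) k ≃ₐ[k] MvPolynomial (Fin n) k) [Finite ↥(Subgroup.zpowers σ)]
    (a : Fin n) :
    ¬ topologicalKrullDim (Spec (CommRingCat.of (FixedPoints.subalgebra k (MvPolynomial (Fin n) k)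
      (Subgroup.zpowers σ)))) ≤ 0 := by
  rw [AffineQuotient.topologicalKrullDim_spec_fixedPoints k,
    AffineQuotient.topologicalKrullDim_spec_mvPolynomial k n]
  have hn : (0 : WithBot ℕ∞) < (n : WithBot ℕ∞) := by exact_mod_cast Fin.pos a
  exact not_le.mpr hn

/-! ## Every open inside the smooth chart is regular -/

/-- **An open of `Bl_{I₆} 𝔸ⁿ` contained in `V[⊤, x_c⁶]` is a regular scheme.** [OURS · L1 W4.5c]
[folklore; assembly of landed decls] -/
theorem isRegular_of_le_blowupChart_I6_c (k : Type) [Field k] (n : ℕ) (a b c : Fin n)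
    (hab : a ≠ b) (hbc : b ≠ c) (hac : a ≠ c)
    (O : (affineBlowup (Ideal.span (Set.range
      (![X a ^ 2, X a * X b ^ 2, X a * X b * X c, X a * X c ^ 3, X b ^ 3, X b ^ 2 * X c ^ 2,
        X b * X c ^ 4, X c ^ 6] : Fin 8 → MvPolynomial (Fin n) k)))).Opens)
    (hO : O ≤ blowupChart
      (affineBlowup.π (Ideal.span (Set.range
        (![X a ^ 2, X a * X b ^ 2, X a * X b * X c, X a * X c ^ 3, X b ^ 3, X b ^ 2 * X c ^ 2,
          X b * X c ^ 4, X c ^ 6] : Fin 8 → MvPolynomial (Fin n) k))))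
      (affineBlowup.idealSheaf (Ideal.span (Set.range
        (![X a ^ 2, X a * X b ^ 2, X a * X b * X c, X a * X c ^ 3, X b ^ 3, X b ^ 2 * X c ^ 2,
          X b * X c ^ 4, X c ^ 6] : Fin 8 → MvPolynomial (Fin n) k))))
      ⟨⊤, isAffineOpen_top _⟩
      ((Scheme.ΓSpecIso (CommRingCat.of (MvPolynomial (Fin n) k))).inv.hom (X c ^ 6))) :
    Scheme.IsRegular (O : Scheme.{0}) := by
  have hIdeal : (affineBlowup.idealSheaf (Ideal.span (Set.range
      (![X a ^ 2, X a * X b ^ 2, X a * X b * X c, X a * X c ^ 3, X b ^ 3, X b ^ 2 * X c ^ 2,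
        X b * X c ^ 4, X c ^ 6] : Fin 8 → MvPolynomial (Fin n) k)))).ideal ⟨⊤, isAffineOpen_top _⟩ =
      (Ideal.span (Set.range
        (![X a ^ 2, X a * X b ^ 2, X a * X b * X c, X a * X c ^ 3, X b ^ 3, X b ^ 2 * X c ^ 2,
          X b * X c ^ 4, X c ^ 6] : Fin 8 → MvPolynomial (Fin n) k))).map
        (Scheme.ΓSpecIso (CommRingCat.of (MvPolynomial (Fin n) k))).inv.hom := by
    change (Scheme.IdealSheafData.ofIdealTop _).ideal ⟨⊤, isAffineOpen_top _⟩ = _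
    rw [ideal_ofIdealTop_top]
  have hxc : (Scheme.ΓSpecIso (CommRingCat.of (MvPolynomial (Fin n) k))).inv.hom (X c ^ 6) ∈
      (affineBlowup.idealSheaf (Ideal.span (Set.range
        (![X a ^ 2, X a * X b ^ 2, X a * X b * X c, X a * X c ^ 3, X b ^ 3, X b ^ 2 * X c ^ 2,
          X b * X c ^ 4, X c ^ 6] : Fin 8 → MvPolynomial (Fin n) k)))).ideal
        ⟨⊤, isAffineOpen_top _⟩ := by
    rw [hIdeal]
    exact Ideal.mem_map_of_mem _ (Ideal.subset_span ⟨7, rfl⟩)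
  exact BlowupExit.isRegular_of_le hO
    (BlowupExit.isRegular_blowupChart_of_isRegularRing (affineBlowup.isBlowup _)
      ⟨⊤, isAffineOpen_top _⟩ hxc (isRegularRing_blowupAlgebra_idealSheaf_I6_c k n a b c hab hbc hac))

/-! ## The stable core `⋂_g g⁻¹ V[⊤, x_c⁶]` of the smooth chart -/

/-- **The stable core of `V[⊤, x_c⁶]` is an affine open.** [folklore] -/
theorem isAffineOpen_core_chartC (k : Type) [Field k] (n : ℕ)
    (σ : MvPolynomial (Fin n) k ≃ₐ[k] MvPolynomial (Fin n) k) [Finite ↥(Subgroup.zpowers σ)]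
    (a b c : Fin n)
    (ha : σ (X a) = X a) (hb : σ (X b) = X b + X a) (hc : σ (X c) = X c + X b)
    (ρ : ↥(Subgroup.zpowers σ) →* Aut (Spec (CommRingCat.of (MvPolynomial (Fin n) k))))
    (hρ : ∀ g : ↥(Subgroup.zpowers σ), (ρ g).hom = Spec.map (CommRingCat.ofHom
      ((MulSemiringAction.toRingEquiv (↥(Subgroup.zpowers σ)) (MvPolynomial (Fin n) k) g⁻¹ :
        MvPolynomial (Fin n) k ≃+* MvPolynomial (Fin n) k) :
          MvPolynomial (Fin n) k →+* MvPolynomial (Fin n) k))) :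
    IsAffineOpen (⨅ g : ↥(Subgroup.zpowers σ),
        (((affineBlowup.isBlowup (Ideal.span (Set.range
          (![X a ^ 2, X a * X b ^ 2, X a * X b * X c, X a * X c ^ 3, X b ^ 3, X b ^ 2 * X c ^ 2,
            X b * X c ^ 4, X c ^ 6] : Fin 8 → MvPolynomial (Fin n) k)))).liftAction ρ
          (idealSheaf_I6_comap k n σ a b c ha hb hc ρ hρ)) g).hom ⁻¹ᵁ
        blowupChart
          (affineBlowup.π (Ideal.span (Set.range
            (![X a ^ 2, X a * X b ^ 2, X a * X b * X c, X a * X c ^ 3, X b ^ 3, X b ^ 2 * X c ^ 2,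
              X b * X c ^ 4, X c ^ 6] : Fin 8 → MvPolynomial (Fin n) k))))
          (affineBlowup.idealSheaf (Ideal.span (Set.range
            (![X a ^ 2, X a * X b ^ 2, X a * X b * X c, X a * X c ^ 3, X b ^ 3, X b ^ 2 * X c ^ 2,
              X b * X c ^ 4, X c ^ 6] : Fin 8 → MvPolynomial (Fin n) k))))
          ⟨⊤, isAffineOpen_top _⟩
          ((Scheme.ΓSpecIso (CommRingCat.of (MvPolynomial (Fin n) k))).inv.hom (X c ^ 6))) := by
  have hIdeal : (affineBlowup.idealSheaf (Ideal.span (Set.range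
      (![X a ^ 2, X a * X b ^ 2, X a * X b * X c, X a * X c ^ 3, X b ^ 3, X b ^ 2 * X c ^ 2,
        X b * X c ^ 4, X c ^ 6] : Fin 8 → MvPolynomial (Fin n) k)))).ideal ⟨⊤, isAffineOpen_top _⟩ =
      (Ideal.span (Set.range
        (![X a ^ 2, X a * X b ^ 2, X a * X b * X c, X a * X c ^ 3, X b ^ 3, X b ^ 2 * X c ^ 2,
          X b * X c ^ 4, X c ^ 6] : Fin 8 → MvPolynomial (Fin n) k))).map
        (Scheme.ΓSpecIso (CommRingCat.of (MvPolynomial (Fin n) k))).inv.hom := by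
    change (Scheme.IdealSheafData.ofIdealTop _).ideal ⟨⊤, isAffineOpen_top _⟩ = _
    rw [ideal_ofIdealTop_top]
  have hxc : (Scheme.ΓSpecIso (CommRingCat.of (MvPolynomial (Fin n) k))).inv.hom (X c ^ 6) ∈
      (affineBlowup.idealSheaf (Ideal.span (Set.range
        (![X a ^ 2, X a * X b ^ 2, X a * X b * X c, X a * X c ^ 3, X b ^ 3, X b ^ 2 * X c ^ 2,
          X b * X c ^ 4, X c ^ 6] : Fin 8 → MvPolynomial (Fin n) k)))).ideal
        ⟨⊤, isAffineOpen_top _⟩ := by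
    rw [hIdeal]
    exact Ideal.mem_map_of_mem _ (Ideal.subset_span ⟨7, rfl⟩)
  exact IsAffineOpen.iInf fun g =>
    ((affineBlowup.isBlowup _).isAffineOpen_blowupChart hxc).preimage _

/-- **The stable core of `V[⊤, x_c⁶]` is stable.** [folklore] -/
theorem preimage_core_chartC_eq (k : Type) [Field k] (n : ℕ)
    (σ : MvPolynomial (Fin n) k ≃ₐ[k] MvPolynomial (Fin n) k) [Finite ↥(Subgroup.zpowers σ)]
    (a b c : Fin n)
    (ha : σ (X a) = X a) (hb : σ (X b) = X b + X a) (hc : σ (X c) = X c + X b)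
    (ρ : ↥(Subgroup.zpowers σ) →* Aut (Spec (CommRingCat.of (MvPolynomial (Fin n) k))))
    (hρ : ∀ g : ↥(Subgroup.zpowers σ), (ρ g).hom = Spec.map (CommRingCat.ofHom
      ((MulSemiringAction.toRingEquiv (↥(Subgroup.zpowers σ)) (MvPolynomial (Fin n) k) g⁻¹ :
        MvPolynomial (Fin n) k ≃+* MvPolynomial (Fin n) k) :
          MvPolynomial (Fin n) k →+* MvPolynomial (Fin n) k)))
    (h : ↥(Subgroup.zpowers σ)) :
    (((affineBlowup.isBlowup (Ideal.span (Set.range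
        (![X a ^ 2, X a * X b ^ 2, X a * X b * X c, X a * X c ^ 3, X b ^ 3, X b ^ 2 * X c ^ 2,
          X b * X c ^ 4, X c ^ 6] : Fin 8 → MvPolynomial (Fin n) k)))).liftAction ρ
        (idealSheaf_I6_comap k n σ a b c ha hb hc ρ hρ)) h).hom ⁻¹ᵁ
      (⨅ g : ↥(Subgroup.zpowers σ),
        (((affineBlowup.isBlowup (Ideal.span (Set.range
          (![X a ^ 2, X a * X b ^ 2, X a * X b * X c, X a * X c ^ 3, X b ^ 3, X b ^ 2 * X c ^ 2,
            X b * X c ^ 4, X c ^ 6] : Fin 8 → MvPolynomial (Fin n) k)))).liftAction ρ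
          (idealSheaf_I6_comap k n σ a b c ha hb hc ρ hρ)) g).hom ⁻¹ᵁ
        blowupChart
          (affineBlowup.π (Ideal.span (Set.range
            (![X a ^ 2, X a * X b ^ 2, X a * X b * X c, X a * X c ^ 3, X b ^ 3, X b ^ 2 * X c ^ 2,
              X b * X c ^ 4, X c ^ 6] : Fin 8 → MvPolynomial (Fin n) k))))
          (affineBlowup.idealSheaf (Ideal.span (Set.range
            (![X a ^ 2, X a * X b ^ 2, X a * X b * X c, X a * X c ^ 3, X b ^ 3, X b ^ 2 * X c ^ 2,
              X b * X c ^ 4, X c ^ 6] : Fin 8 → MvPolynomial (Fin n) k))))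
          ⟨⊤, isAffineOpen_top _⟩
          ((Scheme.ΓSpecIso (CommRingCat.of (MvPolynomial (Fin n) k))).inv.hom (X c ^ 6))) =
      ⨅ g : ↥(Subgroup.zpowers σ),
        (((affineBlowup.isBlowup (Ideal.span (Set.range
          (![X a ^ 2, X a * X b ^ 2, X a * X b * X c, X a * X c ^ 3, X b ^ 3, X b ^ 2 * X c ^ 2,
            X b * X c ^ 4, X c ^ 6] : Fin 8 → MvPolynomial (Fin n) k)))).liftAction ρ
          (idealSheaf_I6_comap k n σ a b c ha hb hc ρ hρ)) g).hom ⁻¹ᵁ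
        blowupChart
          (affineBlowup.π (Ideal.span (Set.range
            (![X a ^ 2, X a * X b ^ 2, X a * X b * X c, X a * X c ^ 3, X b ^ 3, X b ^ 2 * X c ^ 2,
              X b * X c ^ 4, X c ^ 6] : Fin 8 → MvPolynomial (Fin n) k))))
          (affineBlowup.idealSheaf (Ideal.span (Set.range
            (![X a ^ 2, X a * X b ^ 2, X a * X b * X c, X a * X c ^ 3, X b ^ 3, X b ^ 2 * X c ^ 2,
              X b * X c ^ 4, X c ^ 6] : Fin 8 → MvPolynomial (Fin n) k))))
          ⟨⊤, isAffineOpen_top _⟩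
          ((Scheme.ΓSpecIso (CommRingCat.of (MvPolynomial (Fin n) k))).inv.hom (X c ^ 6)) :=
  ToricExit.preimage_iInf_preimage_eq _ _ h

/-- **The stable core of `V[⊤, x_c⁶]` lies in the chart.** [folklore] -/
theorem core_chartC_le (k : Type) [Field k] (n : ℕ)
    (σ : MvPolynomial (Fin n) k ≃ₐ[k] MvPolynomial (Fin n) k)
    (a b c : Fin n)
    (ha : σ (X a) = X a) (hb : σ (X b) = X b + X a) (hc : σ (X c) = X c + X b)
    (ρ : ↥(Subgroup.zpowers σ) →* Aut (Spec (CommRingCat.of (MvPolynomial (Fin n) k))))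
    (hρ : ∀ g : ↥(Subgroup.zpowers σ), (ρ g).hom = Spec.map (CommRingCat.ofHom
      ((MulSemiringAction.toRingEquiv (↥(Subgroup.zpowers σ)) (MvPolynomial (Fin n) k) g⁻¹ :
        MvPolynomial (Fin n) k ≃+* MvPolynomial (Fin n) k) :
          MvPolynomial (Fin n) k →+* MvPolynomial (Fin n) k))) :
    (⨅ g : ↥(Subgroup.zpowers σ),
        (((affineBlowup.isBlowup (Ideal.span (Set.range
          (![X a ^ 2, X a * X b ^ 2, X a * X b * X c, X a * X c ^ 3, X b ^ 3, X b ^ 2 * X c ^ 2,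
            X b * X c ^ 4, X c ^ 6] : Fin 8 → MvPolynomial (Fin n) k)))).liftAction ρ
          (idealSheaf_I6_comap k n σ a b c ha hb hc ρ hρ)) g).hom ⁻¹ᵁ
        blowupChart
          (affineBlowup.π (Ideal.span (Set.range
            (![X a ^ 2, X a * X b ^ 2, X a * X b * X c, X a * X c ^ 3, X b ^ 3, X b ^ 2 * X c ^ 2,
              X b * X c ^ 4, X c ^ 6] : Fin 8 → MvPolynomial (Fin n) k))))
          (affineBlowup.idealSheaf (Ideal.span (Set.range
            (![X a ^ 2, X a * X b ^ 2, X a * X b * X c, X a * X c ^ 3, X b ^ 3, X b ^ 2 * X c ^ 2,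
              X b * X c ^ 4, X c ^ 6] : Fin 8 → MvPolynomial (Fin n) k))))
          ⟨⊤, isAffineOpen_top _⟩
          ((Scheme.ΓSpecIso (CommRingCat.of (MvPolynomial (Fin n) k))).inv.hom (X c ^ 6))) ≤
      blowupChart
        (affineBlowup.π (Ideal.span (Set.range
          (![X a ^ 2, X a * X b ^ 2, X a * X b * X c, X a * X c ^ 3, X b ^ 3, X b ^ 2 * X c ^ 2,
            X b * X c ^ 4, X c ^ 6] : Fin 8 → MvPolynomial (Fin n) k))))
        (affineBlowup.idealSheaf (Ideal.span (Set.range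
          (![X a ^ 2, X a * X b ^ 2, X a * X b * X c, X a * X c ^ 3, X b ^ 3, X b ^ 2 * X c ^ 2,
            X b * X c ^ 4, X c ^ 6] : Fin 8 → MvPolynomial (Fin n) k))))
        ⟨⊤, isAffineOpen_top _⟩
        ((Scheme.ΓSpecIso (CommRingCat.of (MvPolynomial (Fin n) k))).inv.hom (X c ^ 6)) :=
  ToricExit.iInf_preimage_le _ _

/-- **The stable core of `V[⊤, x_c⁶]` is a regular scheme** (the input `hreg₂` of
`ToricExit.toricExitTransfer₃` for the piece `O₂ :=` the core). [OURS · L1 W4.5c]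
[folklore; assembly of landed decls] -/
theorem isRegular_core_chartC (k : Type) [Field k] (n : ℕ)
    (σ : MvPolynomial (Fin n) k ≃ₐ[k] MvPolynomial (Fin n) k)
    (a b c : Fin n) (hab : a ≠ b) (hbc : b ≠ c) (hac : a ≠ c)
    (ha : σ (X a) = X a) (hb : σ (X b) = X b + X a) (hc : σ (X c) = X c + X b)
    (ρ : ↥(Subgroup.zpowers σ) →* Aut (Spec (CommRingCat.of (MvPolynomial (Fin n) k))))
    (hρ : ∀ g : ↥(Subgroup.zpowers σ), (ρ g).hom = Spec.map (CommRingCat.ofHom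
      ((MulSemiringAction.toRingEquiv (↥(Subgroup.zpowers σ)) (MvPolynomial (Fin n) k) g⁻¹ :
        MvPolynomial (Fin n) k ≃+* MvPolynomial (Fin n) k) :
          MvPolynomial (Fin n) k →+* MvPolynomial (Fin n) k))) :
    Scheme.IsRegular ((⨅ g : ↥(Subgroup.zpowers σ),
        (((affineBlowup.isBlowup (Ideal.span (Set.range
          (![X a ^ 2, X a * X b ^ 2, X a * X b * X c, X a * X c ^ 3, X b ^ 3, X b ^ 2 * X c ^ 2,
            X b * X c ^ 4, X c ^ 6] : Fin 8 → MvPolynomial (Fin n) k)))).liftAction ρ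
          (idealSheaf_I6_comap k n σ a b c ha hb hc ρ hρ)) g).hom ⁻¹ᵁ
        blowupChart
          (affineBlowup.π (Ideal.span (Set.range
            (![X a ^ 2, X a * X b ^ 2, X a * X b * X c, X a * X c ^ 3, X b ^ 3, X b ^ 2 * X c ^ 2,
              X b * X c ^ 4, X c ^ 6] : Fin 8 → MvPolynomial (Fin n) k))))
          (affineBlowup.idealSheaf (Ideal.span (Set.range
            (![X a ^ 2, X a * X b ^ 2, X a * X b * X c, X a * X c ^ 3, X b ^ 3, X b ^ 2 * X c ^ 2,
              X b * X c ^ 4, X c ^ 6] : Fin 8 → MvPolynomial (Fin n) k))))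
          ⟨⊤, isAffineOpen_top _⟩
          ((Scheme.ΓSpecIso (CommRingCat.of (MvPolynomial (Fin n) k))).inv.hom (X c ^ 6)) :
        (affineBlowup (Ideal.span (Set.range
          (![X a ^ 2, X a * X b ^ 2, X a * X b * X c, X a * X c ^ 3, X b ^ 3, X b ^ 2 * X c ^ 2,
            X b * X c ^ 4, X c ^ 6] : Fin 8 → MvPolynomial (Fin n) k)))).Opens) : Scheme.{0}) :=
  isRegular_of_le_blowupChart_I6_c k n a b c hab hbc hac _ (core_chartC_le k n σ a b c ha hb hc ρ hρ)

end Summit.ResolutionOfSingularities.ResolutionOfSingularities.Theorems.WildQuotientResolution.JordanFour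

end
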